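import Mathlib
import Literature.AlgebraicGeometry.Resolution.AffineBlowup
import Literature.AlgebraicGeometry.Resolution.AffineBlowupCartier
import Literature.AlgebraicGeometry.Resolution.Blowups
import Literature.AlgebraicGeometry.Resolution.BlowupPrincipalCharts
import HarnessLib

/-!
# The quotient chart under an ambient chart, III: sections of the principal chart `V'[U, b]`

Topic: `Summits/ResolutionOfSingularities/ResolutionOfSingularities/Theorems`. Helper file of the
stub `stub_qs_atlas_quotient` of the line `Sketch` of the crux
`Theses.WeightedInvariant.DatumToEmbedded` (statement `stmt-ResolutionOfSingularities-0572`) of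
the summit `Summit.ResolutionOfSingularities.ResolutionOfSingularities`.

For a blowing up `π : X' ⟶ X` along `I` (`IsBlowup`, `Literature/…/Blowups.lean`), an affine
open `U ⊆ X` and `b ∈ I(U)`, the principal chart `X'[U, b] = blowupChart π I U b`
(`Literature/…/BlowupPrincipalCharts.lean`) is the image of the chart `D₊(bt) = Spec (A[It])_{(bt)}`
of `Bl_{I(U)}(Spec A)`, `A = Γ(X, U)` (`IsBlowup.blowupChart_eq_image`), so its ring of
sections is the affine blowup algebra `A[I(U)/b]` (Stacks, Tag 0804 and Tag 052Q: every element
of `A[I/b]` is "represented by an expression of the form `x/bⁿ` with `x ∈ Iⁿ`"):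

* `appLE_blowupChart_mem_nonZeroDivisors` — (Q2) `π♯b` is a non-zero-divisor on `X'[U, b]`;
* `mk_mul_pow_reesChartBase_eq`, `exists_mem_pow_mul_pow_reesChartBase_eq` — in `(A[It])_{(bt)}`:
  `(a tᵐ)/(bt)ᵐ · (b/1)ᵐ = a/1`, hence every element `y` satisfies `y · (b/1)ᵐ = a/1` for some
  `a ∈ Iᵐ` (the tree's `exists_mul_pow_reesChartBase_eq` with the membership `a ∈ Iᵐ` recorded);
* `exists_ringEquiv_blowupChart` — a ring isomorphism `Γ(X', X'[U, b]) ≃ (A[It])_{(bt)}` taking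
  `π♯s` to `s/1`;
* `exists_of_section_blowupChart` — (Q3) every section `c'` of `X'[U, b]` satisfies
  `c' · π♯b^l = π♯c` for some `l` and `c ∈ I(U)^l`;
* `exists_section_blowupChart` — (Q3') conversely every `c ∈ I(U)^l` is `c' · π♯b^l` on the chart;
* `stub_qs_atlasQuotientRing` — the registered form of (Q3).

All proofs are glue on Mathlib and the tree; no definitions, no named facts.
-/

noncomputable section

open CategoryTheory CategoryTheory.Limits AlgebraicGeometry TopologicalSpace
open Polynomial HomogeneousLocalization
open Literature.AlgebraicGeometry.Resolution

set_option linter.dupNamespace false -- mandated namespace `…Theorems.DatumToEmbedded.<Topic>`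

namespace Summit.ResolutionOfSingularities.ResolutionOfSingularities.Theorems.DatumToEmbedded.AtlasQuotient

universe u

/-! ## (Q2): `π♯b` is a non-zero-divisor on `X'[U, b]` -/

section NZD

variable {X' X : Scheme.{u}} {π : X' ⟶ X} {I : X.IdealSheafData} (hπ : IsBlowup π I)
  {U : X.affineOpens} {b : Γ(X, U)} (hb : b ∈ I.ideal U)

include hπ hb in
/-- **(Q2)** On the principal chart `X'[U, b]` of a blowing up, `π♯b` is a non-zero-divisor
(`IsBlowup.isPrincipalChart_blowupChart`). [cite: StacksProject, Tag 02OS (proof, via Tag 07Z3)] -/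
theorem appLE_blowupChart_mem_nonZeroDivisors :
    π.appLE U (blowupChart π I U b) (blowupChart_le_preimage π I U b) b ∈
      nonZeroDivisors Γ(X', blowupChart π I U b) := by
  obtain ⟨h, hnzd, -⟩ := hπ.isPrincipalChart_blowupChart hb
  exact hnzd

end NZD

/-! ## The affine blowup algebra `(A[It])_{(bt)}`: every element is `a/bᵐ`, `a ∈ Iᵐ` -/

section Algebra

variable {R : Type u} [CommRing R] {I : Ideal R} (b : R) (hb : b ∈ I)

/-- `(a tᵐ)/(bt)ᵐ · (b/1)ᵐ = a/1` in `(R[It])_{(bt)}`. [cite: StacksProject, Tag 0804] -/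
theorem mk_mul_pow_reesChartBase_eq {m : ℕ} {a : R} (p : reesAlgebra I)
    (hp : p ∈ reesGrading I (m • 1)) (ha : (p : R[X]) = monomial (m • 1) a) :
    HomogeneousLocalization.Away.mk (reesGrading I) (reesT_mem b hb) m p hp *
        reesChartBase b hb b ^ m = reesChartBase b hb a := by
  -- adapted from `BlowupsComposition.exists_mul_pow_reesChartBase_eq`
  apply HomogeneousLocalization.val_injective
  rw [HomogeneousLocalization.val_mul, HomogeneousLocalization.val_pow,
    HomogeneousLocalization.Away.val_mk, val_reesChartBase_eq_mk, val_reesChartBase_eq_mk,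
    Localization.mk_pow, Localization.mk_mul, Localization.mk_eq_mk_iff, Localization.r_iff_exists]
  refine ⟨1, Subtype.ext ?_⟩
  simp only [OneMemClass.coe_one, one_mul, SubmonoidClass.coe_pow, Subalgebra.coe_mul, coe_reesT,
    ha, Subalgebra.coe_algebraMap, ← Polynomial.C_eq_algebraMap, monomial_pow, monomial_mul_C,
    smul_eq_mul, mul_one, one_pow]
  rw [← C_pow, monomial_mul_C, mul_comm a]

/-- **Every element of `(R[It])_{(bt)}` is `a/bᵐ` with `a ∈ Iᵐ`**: `y · (b/1)ᵐ = a/1`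
(Stacks 052Q). [cite: StacksProject, Tag 052Q] -/
theorem exists_mem_pow_mul_pow_reesChartBase_eq (y : Away (reesGrading I) (reesT b hb)) :
    ∃ (m : ℕ) (a : R), a ∈ I ^ m ∧ y * reesChartBase b hb b ^ m = reesChartBase b hb a := by
  obtain ⟨m, p, hp, rfl⟩ :=
    HomogeneousLocalization.Away.mk_surjective (reesGrading I) (reesT_mem b hb) y
  obtain ⟨a, ha⟩ := hp
  have ha' : (p : R[X]) = monomial (m • 1) a := ha.symm
  have haI : a ∈ I ^ m := by
    have h := p.2
    rw [ha', reesAlgebra.monomial_mem, smul_eq_mul, mul_one] at h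
    exact h
  exact ⟨m, a, haI, mk_mul_pow_reesChartBase_eq b hb p ⟨a, ha⟩ ha'⟩

/-- Conversely `c/1 = y · (b/1)ˡ` for `c ∈ Iˡ`, with `y = (c tˡ)/(bt)ˡ`. [cite: StacksProject, Tag 052Q] -/
theorem exists_mul_pow_reesChartBase_eq_of_mem_pow {l : ℕ} {c : R} (hc : c ∈ I ^ l) :
    ∃ y : Away (reesGrading I) (reesT b hb), y * reesChartBase b hb b ^ l = reesChartBase b hb c := by
  let p : reesAlgebra I := ⟨monomial l c, reesAlgebra.monomial_mem.mpr hc⟩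
  have hl : (l • 1 : ℕ) = l := by rw [smul_eq_mul, mul_one]
  have hp : p ∈ reesGrading I (l • 1) := ⟨c, by rw [hl]; rfl⟩
  exact ⟨_, mk_mul_pow_reesChartBase_eq b hb p hp (by rw [hl])⟩

end Algebra

/-! ## The sections of `X'[U, b]` are `(A[It])_{(bt)}` -/

section Sections

variable {X' X : Scheme.{u}} {π : X' ⟶ X} {I : X.IdealSheafData} (hπ : IsBlowup π I)
  {U : X.affineOpens} {b : Γ(X, U)} (hb : b ∈ I.ideal U)

/-- `Γ(Spec B, ⊤) ≅ B` undoes its inverse. [folklore] -/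
theorem ΓSpecIso_hom_inv_apply (B : CommRingCat.{u}) (x : B) :
    (Scheme.ΓSpecIso B).hom ((Scheme.ΓSpecIso B).inv x) = x := by
  rw [← CommRingCat.comp_apply, Iso.inv_hom_id, CommRingCat.id_apply]

/-- Through the chart immersion `φ : Bl_{I(U)}(Spec A) ⟶ X'` and the chart `D₊(bt)`, the sections
of `X'` over `φ(D₊(bt))` are `(A[It])_{(bt)}`, with `π♯s ↦ s/1`. [folklore] -/
theorem exists_ringEquiv_image_chartOpen (φ : affineBlowup (I.ideal U) ⟶ X') [IsOpenImmersion φ]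
    (hφ : φ ≫ π = affineBlowup.π (I.ideal U) ≫ U.2.fromSpec)
    (h : φ ''ᵁ (affineBlowup.chartOpen b hb : (affineBlowup (I.ideal U)).Opens) ≤
      π ⁻¹ᵁ (U : X.Opens)) :
    ∃ e : Γ(X', φ ''ᵁ (affineBlowup.chartOpen b hb : (affineBlowup (I.ideal U)).Opens)) ≃+*
        Away (reesGrading (I.ideal U)) (reesT b hb),
      ∀ s : Γ(X, U), e (π.appLE U _ h s) = reesChartBase b hb s := by
  let B : CommRingCat.{u} := CommRingCat.of (Away (reesGrading (I.ideal U)) (reesT b hb))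
  let e₁ : Γ(X', φ ''ᵁ (affineBlowup.chartOpen b hb : (affineBlowup (I.ideal U)).Opens)) ≃+*
      Γ(affineBlowup (I.ideal U), affineBlowup.chartOpen (I := I.ideal U) b hb) :=
    (φ.appIso (affineBlowup.chartOpen b hb : (affineBlowup (I.ideal U)).Opens)).commRingCatIsoToRingEquiv
  let e₂ : Γ(affineBlowup (I.ideal U), affineBlowup.chartOpen (I := I.ideal U) b hb) ≃+*
      Γ(Spec B, ⊤) :=
    ((affineBlowup.chartι (I := I.ideal U) b hb).appIso ⊤).commRingCatIsoToRingEquiv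
  let e₃ : Γ(Spec B, ⊤) ≃+* B := (Scheme.ΓSpecIso B).commRingCatIsoToRingEquiv
  refine ⟨e₁.trans (e₂.trans e₃), fun s => ?_⟩
  have h1 : e₁ (π.appLE U _ h s) =
      affineBlowup.pull (I.ideal U) (affineBlowup.chartOpen b hb) s :=
    appIso_hom_appLE_chartImmersion φ hφ b hb h s
  have h2 : e₂ (affineBlowup.pull (I.ideal U) (affineBlowup.chartOpen b hb) s) =
      (Scheme.ΓSpecIso B).inv (reesChartBase b hb s) :=
    affineBlowup.appIso_hom_pull b hb s
  have h3 : e₃ ((Scheme.ΓSpecIso B).inv (reesChartBase b hb s)) = reesChartBase b hb s :=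
    ΓSpecIso_hom_inv_apply B _
  rw [RingEquiv.trans_apply, RingEquiv.trans_apply, h1, h2, h3]

include hπ hb in
/-- **The ring of sections of the principal chart `X'[U, b]` of a blowing up is the affine
blowup algebra `(A[It])_{(bt)} ≅ A[I(U)/b]`**, `A = Γ(X, U)`, with `π♯s ↦ s/1` (Stacks 0804).
[cite: StacksProject, Tag 0804] -/
theorem exists_ringEquiv_blowupChart :
    ∃ e : Γ(X', blowupChart π I U b) ≃+* Away (reesGrading (I.ideal U)) (reesT b hb),
      ∀ s : Γ(X, U), e (π.appLE U (blowupChart π I U b) (blowupChart_le_preimage π I U b) s) =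
        reesChartBase b hb s := by
  obtain ⟨φ, _, hφ, hrange⟩ := hπ.exists_chartImmersion U
  have key : ∀ (W : X'.Opens) (hW : W ≤ π ⁻¹ᵁ (U : X.Opens)),
      W = φ ''ᵁ (affineBlowup.chartOpen b hb : (affineBlowup (I.ideal U)).Opens) →
      ∃ e : Γ(X', W) ≃+* Away (reesGrading (I.ideal U)) (reesT b hb),
        ∀ s : Γ(X, U), e (π.appLE U W hW s) = reesChartBase b hb s := by
    intro W hW hWeq
    subst hWeq
    exact exists_ringEquiv_image_chartOpen hb φ hφ hW
  exact key _ _ (hπ.blowupChart_eq_image φ hφ hrange b hb)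

include hπ hb in
/-- **(Q3) Every section of the principal chart is `π♯c / π♯b^l` with `c ∈ I(U)^l`.**
[cite: StacksProject, Tag 052Q] -/
theorem exists_of_section_blowupChart (c' : Γ(X', blowupChart π I U b)) :
    ∃ (l : ℕ) (c : Γ(X, U)), c ∈ I.ideal U ^ l ∧
      c' * π.appLE U (blowupChart π I U b) (blowupChart_le_preimage π I U b) b ^ l =
        π.appLE U (blowupChart π I U b) (blowupChart_le_preimage π I U b) c := by
  obtain ⟨e, he⟩ := exists_ringEquiv_blowupChart hπ hb
  obtain ⟨l, c, hc, hy⟩ := exists_mem_pow_mul_pow_reesChartBase_eq b hb (e c')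
  refine ⟨l, c, hc, e.injective ?_⟩
  rw [map_mul, map_pow, he, he, hy]

include hπ hb in
/-- **(Q3') Conversely, every `c ∈ I(U)^l` is `c' · π♯b^l` on the principal chart.**
[cite: StacksProject, Tag 052Q] -/
theorem exists_section_blowupChart {l : ℕ} {c : Γ(X, U)} (hc : c ∈ I.ideal U ^ l) :
    ∃ c' : Γ(X', blowupChart π I U b),
      c' * π.appLE U (blowupChart π I U b) (blowupChart_le_preimage π I U b) b ^ l =
        π.appLE U (blowupChart π I U b) (blowupChart_le_preimage π I U b) c := by
  obtain ⟨e, he⟩ := exists_ringEquiv_blowupChart hπ hb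
  obtain ⟨y, hy⟩ := exists_mul_pow_reesChartBase_eq_of_mem_pow b hb hc
  refine ⟨e.symm y, e.injective ?_⟩
  rw [map_mul, map_pow, he, he, e.apply_symm_apply, hy]

end Sections

/-! ## Registered form -/

/-- **Registered sub-goal `stub_qs_atlasQuotientRing`** of the crux (helper of the stub
`stub_qs_atlas_quotient`): every section of the principal chart `X'[U, b]` of a blowing up is
`π♯c / π♯b^l` with `c ∈ I(U)^l` (Stacks 052Q). [cite: StacksProject, Tag 052Q] -/
theorem stub_qs_atlasQuotientRing :
    ∀ {X' X : Scheme.{0}} {π : X' ⟶ X} {I : X.IdealSheafData},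
      Literature.AlgebraicGeometry.Resolution.IsBlowup π I →
      ∀ {U : X.affineOpens} {b : Γ(X, U)}, b ∈ I.ideal U →
      ∀ c' : Γ(X', Literature.AlgebraicGeometry.Resolution.blowupChart π I U b),
        ∃ (l : ℕ) (c : Γ(X, U)), c ∈ I.ideal U ^ l ∧
          c' * π.appLE U (Literature.AlgebraicGeometry.Resolution.blowupChart π I U b)
              (Literature.AlgebraicGeometry.Resolution.blowupChart_le_preimage π I U b) b ^ l =
            π.appLE U (Literature.AlgebraicGeometry.Resolution.blowupChart π I U b)
              (Literature.AlgebraicGeometry.Resolution.blowupChart_le_preimage π I U b) c :=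
  fun hπ _ _ hb c' => exists_of_section_blowupChart hπ hb c'

end Summit.ResolutionOfSingularities.ResolutionOfSingularities.Theorems.DatumToEmbedded.AtlasQuotient

end
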